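import Summits.QuantumFields.BalabanUV.Beta.CovariantTowerL2

/-!
# Beta / MultiscaleRemainderLeibniz — NODE (w4-b), ALGEBRAIC HALF: THE SECOND LEIBNIZ IDENTITY
# `∇_U* ∘ (∂h·) = −M_{Δ_c h} − (∂h·R_Uᵀ·)ᵀ ∘ ∇_U` AND THE DECOMPOSITION OF THE PARAMETRIX KERNEL K(h) (MODEL)

The gen-4 remainder bound (`CovariantTowerRemainder.l2Bound_remainderTerm`) multiplies `‖K(h)‖ ≲ |∂h|` by the GLOBAL
bound `‖G′‖ ≤ σ_k⁻¹`; with a scale-adapted bump (`|∂h| ≍ 1/(M·S)`) and the LOCAL coercivity of a hull of level-`S`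
cells (`‖G′‖ ≍ (LS)²/κ`) the part `∇_U*∘(∂h·)∘G′` of that product is `O(S/M)` — not level-free.  The repair is print's:
move one lattice derivative from `G′` back onto `h`.  This module is the ALGEBRA of that move, for the pv21 component
MODEL on ANY site/bond structure with ISOMETRIC bond matrices:
* `lapH` = the `c²`-weighted lattice Laplacian `Δ_c h` of a scalar `h`; `leibRemR h` = the target-side Leibniz remainder
  with transport `(b, k) ↦ c(b)(∂h)(b)·(R(b)f(b₊))_k` and its transpose `leibRemRT h`; `‖leibRemR(T) h‖ ≤ θ√z`
  (`|c∂h| ≤ θ`, `≤ z` bonds into a site; `R` isometric);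
* **`covDT_comp_leibRem`**: `∇_U* ∘ (leibRem h) = −M_{Δ_c h} − (leibRemRT h) ∘ ∇_U` (needs `R(b)ᵀR(b) = 1`);
* `remK Q h` = the bracket of pv21's `covLapQ_mul_mulOp` (K(h) of [B9] (3.88) for `Δ_U + Q`, `Q` abstract; = `towerK`
  for the tower's level sum) and **`remK_eq`**: `K_Q(h) = (leibRemT h + leibRemRT h) ∘ ∇_U + (M_{Δ_c h} + [M_h, Q])` —
  two FIRST-order Leibniz parts composed with `∇_U` (to be paired with the ENERGY bound of `G′` in `MultiscaleRemainderL2`)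
  plus a multiplication part carrying the SECOND difference of `h` and the averaging commutator
(unit `b2b-balaban-beta-d4-p2`, GEN 9, MODEL crew; O.2 skeleton v1.4.1 §8.9 node (w4-b); [B9] (3.88) / [B6] (2.39)–(2.40)
SHAPE).

HONEST FRAMING: discharging `BetaPertH` makes Bałaban's UV stability UNCONDITIONAL — NOT the continuum limit, NOT the
Clay problem.  HONEST DEPENDENCY (verbatim): «continuum YM on T⁴ ⇐ BetaPertH ∧ nine spine estimates (0/9 proved);
BetaPertH ⇐ (D1) ∧ (D4) ∧ CAP+tail; G-an2-4 gates asym, D1 and NE2/3/4.»  THIS MODULE DISCHARGES NOTHING of `BetaPertH`,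
asserts NOTHING printed and cites nothing as a fact (ABSOLUTE RULE): [folklore] kernel algebra and Cauchy–Schwarz about
the pv21 component MODEL (`covD`, `covDT`, `leibRem(T)`, `mulOp`).  LOCI (shape only): [B9] = `Balaban1985BackgroundPropagators`
(3.88) p. 409 (*"(Δ′_a hλ)(x) = h(x)(Δ′_aλ)(x) − Σ_{b∈st(x)}(∂h)(b)(Dλ)(b) + (Δh)(x)λ(x) + …"*); [B6] =
`Balaban1984PropagatorsII` (2.39)–(2.40) pp. 229–230.  Print's `c ≡ η⁻¹` is constant; here `c` is a general bond weight
and `Δ_c h` carries `c²` bondwise.  No class change on row D4 (critical-path width 0; D4 DISCHARGE NO DATE); NOT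
BetaPertH, NOT continuum, NOT Clay, NOT summit progress.
-/

namespace Summit.QuantumFields.BalabanUV.Beta.MultiscaleRemainderLeibniz

open Finset
open Literature.MathematicalPhysics.QuantumFieldTheory.Balaban1983to89
open B9Thm37Sum B9Thm37Glue
open B9Thm37GlueTorusCovCT (sum_sq_Rm_apply sum_comp_le_of_card_fiber_le)
open Summit.QuantumFields.BalabanUV.Beta.CovariantTowerL2

noncomputable section

/-! ## §1  The second Leibniz identity and the decomposition of K(h) -/

section Defs

variable {St Bd Cp : Type} (src tgt : Bd → St) (c : Bd → ℝ) (Rm : Bd → Cp → Cp → ℝ)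

/-- MODEL: **the `c²`-weighted lattice Laplacian of a scalar lattice function** `h`:
`(Δ_c h)(x) = Σ_{b : b₋ = x} c(b)²(∂h)(b) − Σ_{b : b₊ = x} c(b)²(∂h)(b)`, `(∂h)(b) = h(b₊) − h(b₋)` (for `c ≡ η⁻¹` on the
torus: `η⁻²Σ_μ (h(x + e_μ) − 2h(x) + h(x − e_μ))`; the coefficient `Δh` of K(h) in [B9] (3.88) / [B6] (2.39) SHAPE).
[cite: Balaban1985BackgroundPropagators, (3.88) p.409; Balaban1984PropagatorsII, (2.39) p.229] -/
def lapH [Fintype Bd] [DecidableEq St] (h : St → ℝ) (x : St) : ℝ :=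
  ∑ b, ((if src b = x then c b ^ 2 * (h (tgt b) - h (src b)) else 0) -
    (if tgt b = x then c b ^ 2 * (h (tgt b) - h (src b)) else 0))

/-- MODEL: the TARGET-side Leibniz remainder with transport, `(leibRemR h f)(b, k) = c(b)(∂h)(b)·Σ_j R(b)_{kj} f(b₊, j)`.
[folklore] -/
def leibRemR [Fintype Cp] (h : St → ℝ) : (St × Cp → ℝ) →ₗ[ℝ] (Bd × Cp → ℝ) where
  toFun f := fun q => c q.1 * (h (tgt q.1) - h (src q.1)) * ∑ j, Rm q.1 q.2 j * f (tgt q.1, j)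
  map_add' f f' := by
    funext q
    simp only [Pi.add_apply, mul_add, Finset.sum_add_distrib]
  map_smul' r f := by
    funext q
    simp only [Pi.smul_apply, smul_eq_mul, RingHom.id_apply, Finset.mul_sum]
    exact Finset.sum_congr rfl fun j _ => by ring

/-- Unfolding of `leibRemR`. [folklore] -/
@[simp] theorem leibRemR_apply [Fintype Cp] (h : St → ℝ) (f : St × Cp → ℝ) (q : Bd × Cp) :
    leibRemR src tgt c Rm h f q = c q.1 * (h (tgt q.1) - h (src q.1)) * ∑ j, Rm q.1 q.2 j * f (tgt q.1, j) := rfl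

/-- MODEL: the transpose of `leibRemR h`: `(leibRemRT h g)(x, i) = Σ_{b : b₊ = x} c(b)(∂h)(b)·Σ_k R(b)_{ki} g(b, k)`. [folklore] -/
def leibRemRT [Fintype Bd] [Fintype Cp] [DecidableEq St] (h : St → ℝ) : (Bd × Cp → ℝ) →ₗ[ℝ] (St × Cp → ℝ) where
  toFun g := fun p => ∑ b, (if tgt b = p.1 then c b * (h (tgt b) - h (src b)) else 0) * ∑ k, Rm b k p.2 * g (b, k)
  map_add' g g' := by
    funext p
    simp only [Pi.add_apply, mul_add, Finset.sum_add_distrib]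
  map_smul' r g := by
    funext p
    simp only [Pi.smul_apply, smul_eq_mul, RingHom.id_apply, Finset.mul_sum]
    exact Finset.sum_congr rfl fun b _ => Finset.sum_congr rfl fun k _ => by ring

/-- Unfolding of `leibRemRT`. [folklore] -/
theorem leibRemRT_apply [Fintype Bd] [Fintype Cp] [DecidableEq St] (h : St → ℝ) (g : Bd × Cp → ℝ) (p : St × Cp) :
    leibRemRT src tgt c Rm h g p =
      ∑ b, (if tgt b = p.1 then c b * (h (tgt b) - h (src b)) else 0) * ∑ k, Rm b k p.2 * g (b, k) := rfl

end Defs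

section Leibniz

variable {St Bd Cp : Type} [Fintype St] [DecidableEq St] [Fintype Bd] [Fintype Cp] [DecidableEq Cp]
  (src tgt : Bd → St) (c : Bd → ℝ) (Rm : Bd → Cp → Cp → ℝ)

omit [DecidableEq Cp] in
/-- `leibRemRT h` is the transpose of `leibRemR h` for the component pairings. [folklore] -/
theorem isTransposePair_leibRemR (h : St → ℝ) :
    IsTransposePair (leibRemR src tgt c Rm h) (leibRemRT src tgt c Rm h) := by
  intro u v
  calc ∑ q, leibRemR src tgt c Rm h u q * v q
      = ∑ b, ∑ k, c b * (h (tgt b) - h (src b)) * (∑ j, Rm b k j * u (tgt b, j)) * v (b, k) := by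
        rw [Fintype.sum_prod_type]
        exact Finset.sum_congr rfl fun b _ => Finset.sum_congr rfl fun k _ => by rw [leibRemR_apply]
    _ = ∑ b, ∑ j, u (tgt b, j) * (c b * (h (tgt b) - h (src b)) * ∑ k, Rm b k j * v (b, k)) := by
        refine Finset.sum_congr rfl fun b _ => ?_
        calc ∑ k, c b * (h (tgt b) - h (src b)) * (∑ j, Rm b k j * u (tgt b, j)) * v (b, k)
            = ∑ k, ∑ j, c b * (h (tgt b) - h (src b)) * (Rm b k j * u (tgt b, j)) * v (b, k) := by
              refine Finset.sum_congr rfl fun k _ => ?_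
              rw [Finset.mul_sum, Finset.sum_mul]
          _ = ∑ j, ∑ k, c b * (h (tgt b) - h (src b)) * (Rm b k j * u (tgt b, j)) * v (b, k) := Finset.sum_comm
          _ = ∑ j, u (tgt b, j) * (c b * (h (tgt b) - h (src b)) * ∑ k, Rm b k j * v (b, k)) := by
              refine Finset.sum_congr rfl fun j _ => ?_
              rw [Finset.mul_sum, Finset.mul_sum]
              exact Finset.sum_congr rfl fun k _ => by ring
    _ = ∑ p : St × Cp, u p * leibRemRT src tgt c Rm h v p := by
        symm
        calc ∑ p : St × Cp, u p * leibRemRT src tgt c Rm h v p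
            = ∑ p : St × Cp, ∑ b, u p * ((if tgt b = p.1 then c b * (h (tgt b) - h (src b)) else 0) *
                ∑ k, Rm b k p.2 * v (b, k)) := by
              refine Finset.sum_congr rfl fun p _ => ?_
              rw [leibRemRT_apply, Finset.mul_sum]
          _ = ∑ b, ∑ p : St × Cp, u p * ((if tgt b = p.1 then c b * (h (tgt b) - h (src b)) else 0) *
                ∑ k, Rm b k p.2 * v (b, k)) := Finset.sum_comm
          _ = ∑ b, ∑ j, u (tgt b, j) * (c b * (h (tgt b) - h (src b)) * ∑ k, Rm b k j * v (b, k)) := by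
              refine Finset.sum_congr rfl fun b _ => ?_
              rw [Fintype.sum_prod_type, Finset.sum_comm]
              refine Finset.sum_congr rfl fun j _ => ?_
              rw [Finset.sum_eq_single (tgt b)]
              · simp
              · intro x _ hx
                rw [if_neg (Ne.symm hx), zero_mul, mul_zero]
              · intro hx
                exact absurd (Finset.mem_univ _) hx

omit [Fintype St] [DecidableEq St] [Fintype Bd] in
/-- Isometric bond matrices: `Σ_k R(b)_{ki}·(Σ_j R(b)_{kj} g_j) = g_i` (`RᵀR = 1`). [folklore] -/
theorem sum_Rm_mul_sum_Rm (hRm : ∀ b i j, ∑ k, Rm b k i * Rm b k j = if i = j then (1 : ℝ) else 0) (b : Bd) (i : Cp)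
    (g : Cp → ℝ) : ∑ k, Rm b k i * ∑ j, Rm b k j * g j = g i := by
  calc ∑ k, Rm b k i * ∑ j, Rm b k j * g j = ∑ k, ∑ j, Rm b k i * Rm b k j * g j := by
        refine Finset.sum_congr rfl fun k _ => ?_
        rw [Finset.mul_sum]
        exact Finset.sum_congr rfl fun j _ => by ring
    _ = ∑ j, (∑ k, Rm b k i * Rm b k j) * g j := by
        rw [Finset.sum_comm]
        exact Finset.sum_congr rfl fun j _ => by rw [Finset.sum_mul]
    _ = g i := by
        simp only [hRm b i]
        rw [Finset.sum_eq_single i]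
        · simp
        · intro j _ hj
          rw [if_neg (Ne.symm hj), zero_mul]
        · intro hi
          exact absurd (Finset.mem_univ _) hi

omit [Fintype St] in
/-- **THE SECOND LEIBNIZ IDENTITY (MODEL; isometric bond matrices)**: `∇_U* ∘ (∂h·) = −M_{Δ_c h} − (leibRemRT h) ∘ ∇_U`,
i.e. site by site `(D*((∂h)·f(b₋)))(x) = −(Δ_c h)(x)·f(x) − Σ_{b : b₊ = x} c(b)(∂h)(b)·R(b)ᵀ(Df)(b)` — the lattice form of
`∇·((∇h)f) = (Δh)f + ∇h·∇f` read through `R(b)ᵀR(b) = 1`; it moves one derivative from the field back onto the bump.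
[cite: Balaban1985BackgroundPropagators, (3.88) p.409; Balaban1984PropagatorsII, (2.39)–(2.40) pp.229–230] -/
theorem covDT_comp_leibRem (hRm : ∀ b i j, ∑ k, Rm b k i * Rm b k j = if i = j then (1 : ℝ) else 0) (h : St → ℝ) :
    covDT src tgt c Rm ∘ₗ leibRem src tgt c h =
      -(mulOp (lapH src tgt c h ∘ Prod.fst)) - leibRemRT src tgt c Rm h ∘ₗ covD src tgt c Rm := by
  apply LinearMap.ext
  intro f
  funext p
  obtain ⟨x, i⟩ := p
  simp only [LinearMap.comp_apply, LinearMap.sub_apply, LinearMap.neg_apply, Pi.sub_apply, Pi.neg_apply, mulOp_apply,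
    Function.comp_apply]
  rw [covDT_apply, leibRemRT_apply, lapH, Finset.sum_mul, neg_eq_neg_one_mul, Finset.mul_sum, ← Finset.sum_sub_distrib]
  refine Finset.sum_congr rfl fun b _ => ?_
  -- the key per-bond identity: Σ_k R_{ki}(Df)(b,k) = c(b)(f(b₊,i) − Σ_k R_{ki} f(b₋,k))
  have hkey : ∑ k, Rm b k i * covD src tgt c Rm f (b, k) =
      c b * (f (tgt b, i) - ∑ k, Rm b k i * f (src b, k)) := by
    calc ∑ k, Rm b k i * covD src tgt c Rm f (b, k)
        = c b * (∑ k, Rm b k i * ∑ j, Rm b k j * f (tgt b, j)) - c b * ∑ k, Rm b k i * f (src b, k) := by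
          rw [Finset.mul_sum, Finset.mul_sum, ← Finset.sum_sub_distrib]
          exact Finset.sum_congr rfl fun k _ => by rw [covD_apply]; ring
      _ = c b * (f (tgt b, i) - ∑ k, Rm b k i * f (src b, k)) := by rw [sum_Rm_mul_sum_Rm Rm hRm b i]; ring
  have e1 : ∑ k, Rm b k i * leibRem src tgt c h f (b, k) =
      c b * (h (tgt b) - h (src b)) * ∑ k, Rm b k i * f (src b, k) := by
    rw [Finset.mul_sum]
    exact Finset.sum_congr rfl fun k _ => by rw [leibRem_apply]; ring
  rw [e1, hkey, leibRem_apply]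
  by_cases ht : tgt b = x <;> by_cases hs : src b = x <;> simp only [ht, hs, ↓reduceIte] <;> ring

omit [Fintype St] [DecidableEq St] [Fintype Bd] in
/-- Isometric bond matrices preserve the component norm: `Σ_k (Σ_j R(b)_{kj} u_j)² = Σ_j u_j²` — pv21's
`sum_sq_Rm_apply`, re-exported for this module's readers. [folklore] -/
theorem sum_sq_transport (hRm : ∀ b i j, ∑ k, Rm b k i * Rm b k j = if i = j then (1 : ℝ) else 0) (b : Bd)
    (u : Cp → ℝ) : ∑ k, (∑ j, Rm b k j * u j) ^ 2 = ∑ j, u j ^ 2 :=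
  sum_sq_Rm_apply Rm hRm b u

/-- **`‖leibRemR h‖ ≤ θ√z`**: `|c(b)(∂h)(b)| ≤ θ` (`θ ≥ 0`), isometric `R`, at most `z` bonds END at a site ⟹
`Σ_q (leibRemR h f)(q)² ≤ θ²z·Σ_p f(p)²`. [folklore] -/
theorem l2Bound_leibRemR (hRm : ∀ b i j, ∑ k, Rm b k i * Rm b k j = if i = j then (1 : ℝ) else 0) (h : St → ℝ)
    {θ : ℝ} (hθ : 0 ≤ θ) (hdh : ∀ b, |c b * (h (tgt b) - h (src b))| ≤ θ) {z : ℕ}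
    (hzt : ∀ x, (univ.filter fun b => tgt b = x).card ≤ z) :
    L2Bound (leibRemR src tgt c Rm h) (θ * Real.sqrt z) := by
  classical
  refine ⟨by positivity, fun v => ?_⟩
  have hF0 : ∀ x, 0 ≤ (fun x => ∑ k, v (x, k) ^ 2) x := fun x => Finset.sum_nonneg fun k _ => sq_nonneg _
  have hterm : ∀ b : Bd, ∑ k, leibRemR src tgt c Rm h v (b, k) ^ 2 ≤ θ ^ 2 * ∑ k, v (tgt b, k) ^ 2 := by
    intro b
    have hsq : (c b * (h (tgt b) - h (src b))) ^ 2 ≤ θ ^ 2 := by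
      rw [← sq_abs (c b * _)]; exact pow_le_pow_left₀ (abs_nonneg _) (hdh b) 2
    calc ∑ k, leibRemR src tgt c Rm h v (b, k) ^ 2
        = (c b * (h (tgt b) - h (src b))) ^ 2 * ∑ k, (∑ j, Rm b k j * v (tgt b, j)) ^ 2 := by
          rw [Finset.mul_sum]
          exact Finset.sum_congr rfl fun k _ => by rw [leibRemR_apply, mul_pow]
      _ = (c b * (h (tgt b) - h (src b))) ^ 2 * ∑ j, v (tgt b, j) ^ 2 := by rw [sum_sq_transport Rm hRm b]
      _ ≤ θ ^ 2 * ∑ k, v (tgt b, k) ^ 2 :=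
          mul_le_mul_of_nonneg_right hsq (Finset.sum_nonneg fun k _ => sq_nonneg _)
  have htgt := sum_comp_le_of_card_fiber_le tgt hzt (fun x => ∑ k, v (x, k) ^ 2) hF0
  calc ∑ q, leibRemR src tgt c Rm h v q ^ 2 = ∑ b, ∑ k, leibRemR src tgt c Rm h v (b, k) ^ 2 :=
        Fintype.sum_prod_type _
    _ ≤ ∑ b, θ ^ 2 * ∑ k, v (tgt b, k) ^ 2 := Finset.sum_le_sum fun b _ => hterm b
    _ = θ ^ 2 * ∑ b, ∑ k, v (tgt b, k) ^ 2 := by rw [Finset.mul_sum]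
    _ ≤ θ ^ 2 * (z * ∑ x, ∑ k, v (x, k) ^ 2) := mul_le_mul_of_nonneg_left htgt (sq_nonneg _)
    _ = (θ * Real.sqrt z) ^ 2 * ∑ p, v p ^ 2 := by
        rw [sum_site_sq, mul_pow, Real.sq_sqrt (Nat.cast_nonneg z)]; ring

/-- **`‖leibRemRT h‖ ≤ θ√z`** (transpose of `l2Bound_leibRemR`). [folklore] -/
theorem l2Bound_leibRemRT (hRm : ∀ b i j, ∑ k, Rm b k i * Rm b k j = if i = j then (1 : ℝ) else 0) (h : St → ℝ)
    {θ : ℝ} (hθ : 0 ≤ θ) (hdh : ∀ b, |c b * (h (tgt b) - h (src b))| ≤ θ) {z : ℕ}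
    (hzt : ∀ x, (univ.filter fun b => tgt b = x).card ≤ z) :
    L2Bound (leibRemRT src tgt c Rm h) (θ * Real.sqrt z) :=
  (l2Bound_leibRemR src tgt c Rm hRm h hθ hdh hzt).transpose (isTransposePair_leibRemR src tgt c Rm h)

/-- MODEL of the parametrix kernel K(h) of [B9] (3.88) for `Δ_U + Q` with `Q` an abstract site operator:
`K_Q(h) = (leibRemT h)∘∇_U − ∇_U*∘(leibRem h) + [M_h, Q]` — literally the bracket of pv21's `covLapQ_mul_mulOp`
(and `towerK` for `Q` = the tower's level sum). [cite: Balaban1985BackgroundPropagators, (3.88) p.409; Balaban1984PropagatorsII, (2.39)–(2.40) pp.229–230] -/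
def remK (Qf : Module.End ℝ (St × Cp → ℝ)) (h : St → ℝ) : Module.End ℝ (St × Cp → ℝ) :=
  leibRemT src tgt c h ∘ₗ covD src tgt c Rm +
    (-(covDT src tgt c Rm ∘ₗ leibRem src tgt c h) + (mulOp (h ∘ Prod.fst) * Qf - Qf * mulOp (h ∘ Prod.fst)))

omit [Fintype St] [DecidableEq Cp] in
/-- **(3.88), first equality, for `Δ_U + Q`**: `(D*D + Q)M_h = M_h(D*D + Q) − K_Q(h)` — pv21's `covLapQ_mul_mulOp`.
[cite: Balaban1985BackgroundPropagators, (3.88) p.409] -/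
theorem covLapQ_mul_mulOp_remK (Qf : Module.End ℝ (St × Cp → ℝ)) (h : St → ℝ) :
    (covDT src tgt c Rm ∘ₗ covD src tgt c Rm + Qf) * mulOp (h ∘ Prod.fst) =
      mulOp (h ∘ Prod.fst) * (covDT src tgt c Rm ∘ₗ covD src tgt c Rm + Qf) - remK src tgt c Rm Qf h :=
  covLapQ_mul_mulOp src tgt c Rm Qf h

omit [Fintype St] in
/-- **THE DECOMPOSITION OF K(h) (MODEL; isometric R)**:
`K_Q(h) = (leibRemT h + leibRemRT h) ∘ ∇_U + (M_{Δ_c h} + [M_h, Q])` — two FIRST-order Leibniz parts composed with `∇_U`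
(to be paired with the energy bound of `G′`) and two multiplication/commutator parts carrying the SECOND difference of
`h` and its block oscillation. [cite: Balaban1985BackgroundPropagators, (3.88) p.409; Balaban1984PropagatorsII, (2.39)–(2.40) pp.229–230] -/
theorem remK_eq (hRm : ∀ b i j, ∑ k, Rm b k i * Rm b k j = if i = j then (1 : ℝ) else 0)
    (Qf : Module.End ℝ (St × Cp → ℝ)) (h : St → ℝ) :
    remK src tgt c Rm Qf h =
      (leibRemT src tgt c h + leibRemRT src tgt c Rm h) ∘ₗ covD src tgt c Rm +
        (mulOp (lapH src tgt c h ∘ Prod.fst) + (mulOp (h ∘ Prod.fst) * Qf - Qf * mulOp (h ∘ Prod.fst))) := by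
  rw [remK, covDT_comp_leibRem src tgt c Rm hRm h, LinearMap.add_comp]
  abel

end Leibniz

end

end Summit.QuantumFields.BalabanUV.Beta.MultiscaleRemainderLeibniz
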